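import Literature.Computability.AlgebraicComplexity.MS2001GenericCircuitForm
import Literature.Computability.AlgebraicComplexity.MS2001FormESymmetries
import Literature.Computability.AlgebraicComplexity.BLMW11HomogenizedDetRepresentations
import Literature.Computability.AlgebraicComplexity.BurgisserBooleanPartsA3Steps
import Mathlib.Algebra.Field.ZMod
import HarnessLib

/-!
# GCT I §7: `F_p`-forms, `F_p`-equivalence, and Prop. 7.9 (the `F_p`-analogue of Prop. 6.1) —
# PROOFS

Topic `Computability/AlgebraicComplexity`. Cell `val-lit`, row MS2001-A (K. Mulmuley, M. Sohoni,
*Geometric complexity theory I*, SIAM J. Comput. 31 (2001) 496–526), §7, typed from the AUTHORS'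
VERSION (AV; text of record `HOME/bip/texts/MS2001-authorversion/`, locators «AV p.N, all.txt
Lnnnn»). Companion of `MS2001GenericCircuitForm.lean` (`H(Y) = genericCircuitForm F k m`,
universality `MS2001GenericCircuit.isProjection_eval`, Prop. 6.1). The row «Prop 7.9» of
`HOME/bip/CHECK-t01.md` was SKIPPED at typing time ("`F_p`-equivalence of forms definable; depends
on `H(Y)`, `O(r²)`"); this file types the two notions of AV p.33 with bodies and PROVES Prop. 7.9,
in general form and for the form `E(X)` of §7 (`msE`). Theorems and bodied definitions only: no
named facts, no instances, no `sorry`.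

## The source (AV p.33, all.txt L2425–2449)

> "Now, we turn to the actual P vs. NP question (the stronger nonuniform version). Here the
> field under consideration is no longer algebraically closed. The base field that is actually
> used for computation in real computers is finite, in fact, `F_2`, though, without of loss of
> generality, we can take it to be `F_p` for any small enough prime. […] We will reduce the P vs.
> NP question to a certain parametrized family of the general orbit-closure or stabilizer
> problems over `F`, where `F` is the algebraic closure of `F_p`.
> The starting point is the following analogue of Proposition 6.1. We say that a form is an
> `F_p`-form if its coefficients are in `F_p`. The two forms `h_1(Y), h_2(Y) ∈ V` are said to be
> `F_p`-equivalent if they are equal for all `F_p`-vectors `Y`; i.e., when we let each entry of `Y`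
> range over `F_p`.
> **Proposition 7.9** If `E(X)`, considered as a function of the `F_p`-vector `X`, has an
> arithmetic circuit over `F_p` of size of `r`, then some `F_p`-form `h` that is `F_p`-equivalent
> to `E^φ(Y)` lies in the projective orbit closure `Δ[H(Y)] ⊆ P(V)`, where the size `l` of `Y` is
> `O(r²)`. *Proof:* Analogous to that of Proposition 4.1.

## Contents

* §1 `homogenization_mem_endOrbit_of_isProjection` — the padding step of Props. 4.1 / 6.1 / 7.9
  for a projection `f` of a form `g` that need NOT be homogeneous: the homogenisation
  `∑_{i ≤ D} X_y^{D-i} f_i(X_ι)` (`f_i` = degree-`i` component, `deg f ≤ D = deg g`) is a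
  linear-substitution instance of `g` (generalises the tree's `homogenization_mem_endOrbit_detPoly`
  from `det` to any form, and `X_pow_mul_rename_mem_endOrbit_of_isProjection` from forms to
  arbitrary projections); `MS2001GenericCircuit.map_genericCircuitForm` (base change of `H(Y)`;
  base change of projections is the tree's `IsProjection.map`, here a private twin).
* §2 The notions of AV p.33 L2436–2441, for a field `F` of characteristic `p` (so `F ⊇ F_p`, the
  prime field, embedded by `ZMod.castHom`): `IsFpForm p F h` ("`h` is an `F_p`-form": its
  coefficients lie in `F_p`, i.e. `h` is the base change of a polynomial over `ZMod p`) and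
  `IsFpEquivalent p F h₁ h₂` ("equal for all `F_p`-vectors").
* §3 `eval_homogenization_eq_X_pow_mul_of_forall_eval_eq` — the key computation: if a polynomial
  `g` (any degree `< D`) and a form `f` of degree `d < D` agree as FUNCTIONS on `K`-points, then the
  degree-`D` homogenisation of `g` and the padded form `X_y^{D-d} f(X_ι)` agree on all `K`-points
  (scale by `x_y` where `x_y ≠ 0`; both vanish where `x_y = 0`).
* §4 **Prop. 7.9** PROVED: `MS2001_prop_7_9_general` (any `F_p`-form `f` computed as a function on
  `F_p^τ` by a fan-in-two circuit over `F_p` with `s` gates: for `k ≥ s + 1`, `m ≥ #τ + s + 1`,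
  `d < 2^{k+1} - 1`, every placement `ι`, `y`, and every infinite field `F` of characteristic `p`,
  SOME `F_p`-form `h`, `F_p`-equivalent to `X_y^{D-d} f(X_ι)`, lies in `Δ[H(Y)]` — namely the
  homogenised circuit polynomial) and `MS2001_prop_7_9` (the printed case `f = E(X)`, the tree's
  `msE`, of degree `n · kk^n`).

## Rendering, constants, deviations (disclosed)

* "has an arithmetic circuit over `F_p` … considered as a function of the `F_p`-vector `X`":
  typed as a fan-in-two circuit `P` over `ZMod p` (the tree's `ArithCircuit`, constants in `F_p`)
  whose polynomial `P.eval` agrees with `E(X)` at every point of `F_p^X` (`∀ z, eval z P.eval =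
  eval z E`) — NOT as a polynomial identity (that is the point of the `F_p`-version: `x^p` and `x`
  are the same function).
* The witness `h` is EXPLICIT: the degree-`D` homogenisation of the circuit polynomial placed at
  `ι`, `y` (the print only asserts existence, "analogous to Prop. 4.1").
* CONSTANTS as in Prop. 6.1 of the companion file: depth `k ≥ s + 1`, width `m ≥ #τ + s + 1`
  for `s` gates (print: `l = O(r²)` with `r` the node count; the exact `l = m + m² + (k-1) m³`,
  `MS2001GenericCircuit.card_var`); in addition `d < D = 2^{k+1} - 1` STRICTLY and `deg P.eval < D`
  (automatic from `k ≥ s + 1`, `totalDegree_eval_le_two_pow_size`): where the homogenising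
  coordinate vanishes both sides must vanish, which is where the `F_p`-equivalence (as opposed to
  an identity of polynomials) needs `D` to exceed both degrees.
* FIELD: print `F = \overline{F_p}`; typed for every INFINITE field `F` of characteristic `p`
  (the density step `End · H ⊆ Δ[H]` needs `F` infinite; `\overline{F_p}` is one). The prime field
  is `ZMod p ↪ F` via `ZMod.castHom`; `p` prime.
* `E(X)`: the tree's `msE F n kk` (GCT I §7, `n × kk·n` variable matrix; the print's `m`, `k`),
  a form of degree `n · kk^n` (`MS2001FormE.msE_isHomogeneous`) with integer coefficients, hence an
  `F_p`-form (`map_msE`).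

Honest framing: literature typing; Prop. 7.9 only transports the circuit-universality of `H(Y)`
to functions on `F_p`-points; the conjectures it serves (7.10, 7.11: "would imply `P ≠ NP`") are
open problems and are NOT typed; nothing here is progress on any separation (`VP ≠ VNP`, `P ≠ NP`
are NOT proved).

## References

* [MulmuleySohoniSIAM2001] K. Mulmuley, M. Sohoni, *Geometric complexity theory I*, SIAM J.
  Comput. 31 (2001) 496–526, §7 (AV p.33, all.txt L2425–2449), Prop. 7.9 (L2442–2449).
* [BurgisserEtAl2011] P. Bürgisser, J.M. Landsberg, L. Manivel, J. Weyman, *An overview of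
  mathematical issues arising in the geometric complexity theory approach to VP ≠ VNP*, SIAM J.
  Comput. 40 (2011), §9.3 (homogenisation; the tree's `eval_homogenization_eq`).
-/

noncomputable section

open MvPolynomial

namespace Literature.Computability.AlgebraicComplexity

universe u v w

/-! ## §1. Homogenised projections lie in the endomorphism orbit; base change -/

section Homogenize

variable {F : Type u} [Field F]

/-- Evaluating a substitution: `(g ∘ a)(x) = g(a(x))` (twin of the tree's private copies). [folklore] -/
private theorem eval_aeval_eq' {ρ τ : Type*} (x : τ → F) (a : ρ → MvPolynomial τ F)
    (g : MvPolynomial ρ F) : eval x (aeval a g) = eval (fun v => eval x (a v)) g := by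
  rw [show aeval a g = bind₁ a g from rfl, eval, eval₂Hom_bind₁]
  rfl

/-- **Homogenised projections of a form lie in its endomorphism orbit** ("analogous to that of
Proposition 4.1", AV p.33 L2449; cf. AV p.13 eq. (3)). Let `g` be a form of degree `D` in the
variables `ρ` and `f = g(a)` a projection of `g` (each `a_v` a variable of `f` or a constant), of
total degree `≤ D` but not necessarily homogeneous. Then for every placement `ι : τ → ρ` and
variable `y`, the degree-`D` homogenisation `∑_{i ≤ D} X_y^{D-i} f_i(X_ι)` is a
linear-substitution instance of `g`: substitute `x_t ↦ X_{ι t}`, `c ↦ c X_y`; compare values where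
`x_y ≠ 0` (`eval_homogenization_eq`), conclude by density (`F` infinite). The tree's
`homogenization_mem_endOrbit_detPoly` is the case `g = det_N`.
[cite: MulmuleySohoniSIAM2001, Prop. 7.9 (proof, AV p.33 L2449) and Prop. 4.1 (proof, AV p.13)] -/
theorem homogenization_mem_endOrbit_of_isProjection [Infinite F] {ρ : Type*} [Fintype ρ]
    [DecidableEq ρ] {τ : Type*} [Fintype τ] {g : MvPolynomial ρ F} {D : ℕ}
    (hg : g.IsHomogeneous D) {f : MvPolynomial τ F} (hfg : IsProjection f g)
    (hdeg : f.totalDegree ≤ D) (ι : τ → ρ) (y : ρ) :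
    (∑ i ∈ Finset.range (D + 1), X y ^ (D - i) * rename ι (homogeneousComponent i f)) ∈
      endOrbit ρ F g := by
  classical
  obtain ⟨a, ha, rfl⟩ := hfg
  have hadeg : ∀ v, (a v).totalDegree ≤ 1 := by
    intro v
    rcases ha v with ⟨j, hj⟩ | ⟨c, hc⟩
    · rw [hj]; exact (totalDegree_X j).le
    · rw [hc, totalDegree_C]; exact Nat.zero_le _
  -- the homogenising substitution matrix
  set M : Matrix ρ ρ F := fun q v =>
    (if q = y then coeff 0 (a v) else 0) +
      ∑ t, if q = ι t then coeff (Finsupp.single t 1) (a v) else 0 with hM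
  refine ⟨M, ?_⟩
  -- values of the substituted variables where `x y ≠ 0`
  have hentry : ∀ (x : ρ → F), x y ≠ 0 → ∀ v : ρ,
      eval x (∑ q, M q v • (X q : MvPolynomial ρ F)) =
        x y * eval (fun t => x (ι t) / x y) (a v) := by
    intro x hx v
    rw [map_sum, eval_eq_of_totalDegree_le_one (hadeg v)]
    simp only [smul_eval, eval_X, hM, add_mul, Finset.sum_add_distrib, Finset.sum_mul, ite_mul,
      zero_mul]
    rw [Finset.sum_comm]
    simp only [mul_add, Finset.mul_sum]
    congr 1
    · rw [Finset.sum_ite_eq' Finset.univ y, if_pos (Finset.mem_univ _)]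
      ring
    · refine Finset.sum_congr rfl fun t _ => ?_
      rw [Finset.sum_ite_eq' Finset.univ (ι t), if_pos (Finset.mem_univ _)]
      field_simp
  -- values of the substituted form where `x y ≠ 0`
  have hval : ∀ (x : ρ → F), x y ≠ 0 →
      eval x (linSubst ρ F M g) = x y ^ D * eval (fun t => x (ι t) / x y) (aeval a g) := by
    intro x hx
    have h1 : linSubst ρ F M g = aeval (fun v => ∑ q, M q v • (X q : MvPolynomial ρ F)) g := rfl
    rw [h1, eval_aeval_eq', eval_aeval_eq']
    have h2 : (fun v => eval x (∑ q, M q v • (X q : MvPolynomial ρ F))) =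
        x y • fun v => eval (fun t => x (ι t) / x y) (a v) := by
      funext v
      rw [hentry x hx v]
      rfl
    rw [h2, eval_smul_of_isHomogeneous hg]
  -- the two polynomials agree where `x y ≠ 0`, hence everywhere
  have hprod : (linSubst ρ F M g - ∑ i ∈ Finset.range (D + 1),
      X y ^ (D - i) * rename ι (homogeneousComponent i (aeval a g))) * X y = 0 := by
    apply MvPolynomial.funext
    intro x
    rw [map_mul, map_sub, map_zero, eval_X]
    by_cases hx : x y = 0
    · rw [hx, mul_zero]
    · rw [hval x hx, eval_homogenization_eq (aeval a g) hdeg ι y x hx, sub_self, zero_mul]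
  have hX : (X y : MvPolynomial ρ F) ≠ 0 := X_ne_zero y
  exact sub_eq_zero.mp ((mul_eq_zero.mp hprod).resolve_right hX)

end Homogenize

section BaseChange

variable {R : Type u} {S : Type v} [CommSemiring R] [CommSemiring S] (φ : R →+* S)

/-- Projections commute with base change (private twin of the tree's `IsProjection.map` in
`TavenasRealTauWithConstantsProofs.lean`, not imported here to keep the import closure small).
[folklore] -/
private theorem isProjection_map' {τ ρ : Type*} {f : MvPolynomial τ R} {g : MvPolynomial ρ R}
    (h : IsProjection f g) : IsProjection (MvPolynomial.map φ f) (MvPolynomial.map φ g) := by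
  obtain ⟨a, ha, rfl⟩ := h
  refine ⟨fun i => MvPolynomial.map φ (a i), fun i => ?_, ?_⟩
  · rcases ha i with ⟨j, hj⟩ | ⟨c, hc⟩
    · exact Or.inl ⟨j, by simp only [hj, map_X]⟩
    · exact Or.inr ⟨φ c, by simp only [hc, map_C]⟩
  · rw [show aeval a g = bind₁ a g from rfl, map_bind₁]
    rfl

/-- Base change does not raise the total degree. [folklore] -/
private theorem totalDegree_map_le' {σ : Type*} (q : MvPolynomial σ R) :
    (MvPolynomial.map φ q).totalDegree ≤ q.totalDegree :=
  Finset.sup_mono (support_map_subset φ q)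

/-- Base change commutes with homogeneous components. [folklore] -/
private theorem homogeneousComponent_map' {σ : Type*} (i : ℕ) (q : MvPolynomial σ R) :
    homogeneousComponent i (MvPolynomial.map φ q) = MvPolynomial.map φ (homogeneousComponent i q) := by
  ext d
  rw [coeff_homogeneousComponent, coeff_map, coeff_map, coeff_homogeneousComponent]
  split_ifs <;> simp

/-- Evaluating a base-changed polynomial at a base-changed point. [folklore] -/
private theorem eval_comp_map' {σ : Type*} (x : σ → R) (q : MvPolynomial σ R) :
    eval (φ ∘ x) (MvPolynomial.map φ q) = φ (eval x q) := by
  rw [eval_map, show eval x q = eval₂ (RingHom.id R) x q from rfl, eval₂_comp_left,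
    RingHom.comp_id]

variable (k m : ℕ)

/-- The node forms of the generic circuit have integer (indeed `0/1`) coefficients: base change
maps them to themselves. [cite: MulmuleySohoniSIAM2001, §6 (AV p.28, all.txt L2019–2025)] -/
theorem MS2001GenericCircuit.map_nodeVal : ∀ (j : ℕ) (u : Fin m),
    MvPolynomial.map φ (MS2001GenericCircuit.nodeVal R k m j u) =
      MS2001GenericCircuit.nodeVal S k m j u
  | 0, u => by simp [map_X]
  | j + 1, u => by
    by_cases hj : j < k - 1
    · rw [MS2001GenericCircuit.nodeVal_succ R k m hj, MS2001GenericCircuit.nodeVal_succ S k m hj]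
      simp only [_root_.map_sum, _root_.map_mul, map_X, MS2001GenericCircuit.map_nodeVal j]
    · simp [MS2001GenericCircuit.nodeVal, hj]

/-- **`H(Y)` is defined over the integers**: base change maps the generic circuit form over `R`
to the generic circuit form over `S` (in particular `H(Y)` over `F ⊇ F_p` is an `F_p`-form).
[cite: MulmuleySohoniSIAM2001, §6 (AV p.28, all.txt L2010–2031)] -/
theorem MS2001GenericCircuit.map_genericCircuitForm :
    MvPolynomial.map φ (genericCircuitForm R k m) = genericCircuitForm S k m := by
  rw [genericCircuitForm, genericCircuitForm]
  simp only [_root_.map_sum, _root_.map_mul, map_X, MS2001GenericCircuit.map_nodeVal]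

end BaseChange

section BaseChangeE

variable {R : Type u} {S : Type v} [CommRing R] [CommRing S] (φ : R →+* S)

/-- **`E(X)` is defined over the integers**: base change maps `E(X)` over `R` to `E(X)` over `S`
(its coefficients are integers — it is a product of determinants of variable matrices; in
particular `E(X)` is an `F_p`-form, AV p.33 L2436). [cite: MulmuleySohoniSIAM2001, §7 (definition of E(X), AV p.30; AV p.33 L2436)] -/
theorem map_msE (n kk : ℕ) : MvPolynomial.map φ (msE R n kk) = msE S n kk := by
  rw [msE, msE, _root_.map_prod]
  refine Finset.prod_congr rfl fun s _ => ?_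
  rw [RingHom.map_det, RingHom.mapMatrix_apply]
  congr 1
  ext r i
  simp [Matrix.map_apply, Matrix.of_apply, map_X]

end BaseChangeE

/-! ## §2. `F_p`-forms and `F_p`-equivalence (AV p.33 L2436–2441) -/

section FpNotions

variable (p : ℕ) (F : Type u) [Field F] [CharP F p]

/-- **`F_p`-form** (AV p.33 L2436–2437: "We say that a form is an `F_p`-form if its coefficients
are in `F_p`"): over a field `F` of characteristic `p` (print: `F = \overline{F_p}`), a
polynomial `h` is an `F_p`-form if it is the base change, along the embedding `F_p ↪ F` of the
prime field (`ZMod.castHom`), of a polynomial with coefficients in `F_p = ZMod p`.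
[cite: MulmuleySohoniSIAM2001, §7 (AV p.33, all.txt L2436–2437)] -/
def IsFpForm {σ : Type v} (h : MvPolynomial σ F) : Prop :=
  ∃ h₀ : MvPolynomial σ (ZMod p), MvPolynomial.map (ZMod.castHom (dvd_refl p) F) h₀ = h

/-- **`F_p`-equivalence** (AV p.33 L2437–2441: "The two forms `h_1(Y), h_2(Y) ∈ V` are said to be
`F_p`-equivalent if they are equal for all `F_p`-vectors `Y`; i.e., when we let each entry of `Y`
range over `F_p`"): `h₁` and `h₂` take the same value at every point all of whose coordinates lie
in the prime field `F_p ⊆ F`. [cite: MulmuleySohoniSIAM2001, §7 (AV p.33, all.txt L2437–2441)] -/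
def IsFpEquivalent {σ : Type v} (h₁ h₂ : MvPolynomial σ F) : Prop :=
  ∀ x : σ → ZMod p,
    eval ((ZMod.castHom (dvd_refl p) F) ∘ x) h₁ = eval ((ZMod.castHom (dvd_refl p) F) ∘ x) h₂

variable {p F}

/-- A base-changed polynomial is an `F_p`-form. [cite: MulmuleySohoniSIAM2001, §7 (AV p.33, all.txt L2436–2437)] -/
theorem isFpForm_map {σ : Type v} (h₀ : MvPolynomial σ (ZMod p)) :
    IsFpForm p F (MvPolynomial.map (ZMod.castHom (dvd_refl p) F) h₀) :=
  ⟨h₀, rfl⟩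

/-- `F_p`-equivalence of base changes is equality of functions on `F_p`-points (`p` prime, so
that `F_p ↪ F` is injective). [cite: MulmuleySohoniSIAM2001, §7 (AV p.33, all.txt L2437–2441)] -/
theorem isFpEquivalent_map_iff [Fact p.Prime] {σ : Type v} (h₁ h₂ : MvPolynomial σ (ZMod p)) :
    IsFpEquivalent p F (MvPolynomial.map (ZMod.castHom (dvd_refl p) F) h₁)
        (MvPolynomial.map (ZMod.castHom (dvd_refl p) F) h₂) ↔
      ∀ x : σ → ZMod p, eval x h₁ = eval x h₂ := by
  simp only [IsFpEquivalent, eval_comp_map']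
  exact ⟨fun h x => (ZMod.castHom (dvd_refl p) F).injective (h x), fun h x => by rw [h x]⟩

end FpNotions

/-! ## §3. The homogenised circuit polynomial is `F_p`-equivalent to the padded form -/

section KeyComputation

variable {K : Type u} [Field K]

/-- **Function-equivalence survives homogenisation.** Let `f` be a form of degree `d` and `g` a
polynomial (not necessarily homogeneous) over a field `K`, which agree as FUNCTIONS on `K^τ`
(`g(z) = f(z)` for all `z`), and let `D` exceed both `d` and `deg g`. Then the degree-`D`
homogenisation `∑_{i ≤ D} X_y^{D-i} g_i(X_ι)` of `g` and the padded form `X_y^{D-d} f(X_ι)` agree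
at every point `x ∈ K^ρ`: where `x_y ≠ 0` both equal `x_y^D · g(x_ι / x_y) = x_y^D · f(x_ι / x_y)`
(homogeneity), where `x_y = 0` both vanish (`D > deg g`, `D > d`). This is the computation
behind "analogous to Prop. 4.1" for functions on `F_p`-points (AV p.33 L2449).
[cite: MulmuleySohoniSIAM2001, Prop. 7.9 (proof, AV p.33 L2449)] -/
theorem eval_homogenization_eq_X_pow_mul_of_forall_eval_eq {τ ρ : Type*} {f g : MvPolynomial τ K}
    {d D : ℕ} (hf : f.IsHomogeneous d) (hdD : d < D) (hg : g.totalDegree < D)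
    (hfg : ∀ z : τ → K, eval z g = eval z f) (ι : τ → ρ) (y : ρ) (x : ρ → K) :
    eval x (∑ i ∈ Finset.range (D + 1), X y ^ (D - i) * rename ι (homogeneousComponent i g)) =
      eval x (X y ^ (D - d) * rename ι f) := by
  by_cases hx : x y = 0
  · -- both sides vanish
    rw [map_mul, map_pow, eval_X, hx, zero_pow (by omega), zero_mul, map_sum]
    refine Finset.sum_eq_zero fun i hi => ?_
    rw [Finset.mem_range] at hi
    rw [map_mul, map_pow, eval_X, hx]
    by_cases hiD : i = D
    · subst hiD
      rw [homogeneousComponent_eq_zero _ _ hg, map_zero, map_zero, mul_zero]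
    · rw [zero_pow (by omega), zero_mul]
  · rw [eval_homogenization_eq g hg.le ι y x hx, hfg, map_mul, map_pow, eval_X, eval_rename]
    have hscale : (fun t => x (ι t) / x y) = (x y)⁻¹ • (x ∘ ι) := by
      funext t
      simp [div_eq_inv_mul]
    rw [hscale, eval_smul_of_isHomogeneous hf, ← mul_assoc]
    congr 1
    rw [← Nat.sub_add_cancel hdD.le, pow_add, Nat.add_sub_cancel, mul_assoc, ← mul_pow,
      mul_inv_cancel₀ hx, one_pow, mul_one]

end KeyComputation

/-! ## §4. Proposition 7.9 -/

section PropSevenNine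

open MS2001GenericCircuit

variable (p : ℕ) [Fact p.Prime] (F : Type u) [Field F] [CharP F p] [Infinite F]

/-- **GCT I, Prop. 7.9, general form** (AV p.33 L2442–2449, "analogous to Proposition 4.1 /
6.1"). Let `f` be an `F_p`-form of degree `d` in the variables `τ` (a form over `ZMod p`) and
suppose that `f`, "considered as a function of the `F_p`-vector", has an arithmetic circuit over
`F_p` with `s` gates: a fan-in-two circuit `P` over `ZMod p` with `P.eval(z) = f(z)` for every
`z ∈ F_p^τ`. Let `H(Y)` be the generic circuit form of depth `k ≥ s + 1` and width
`m ≥ #τ + s + 1`, `D = 2^{k+1} - 1 = deg H(Y) > d`, and let `F ⊇ F_p` be an infinite field of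
characteristic `p` (print: `F = \overline{F_p}`). Then for every placement `ι : τ → Y` and
homogenising variable `y`, SOME `F_p`-form `h` that is `F_p`-equivalent to
`f^φ(Y) = X_y^{D-d} f(X_ι)` lies in `Δ[H(Y)]` — namely the degree-`D` homogenisation of the circuit
polynomial `P.eval` (which is a projection of `H(Y)`, `isProjection_eval`; its homogenisation is
in `End · H ⊆ Δ[H]`, `homogenization_mem_endOrbit_of_isProjection`,
`endOrbit_subset_orbitClosure_holds`; and it is `F_p`-equivalent to `f^φ` because `P.eval` and `f`
agree on `F_p`-points, `eval_homogenization_eq_X_pow_mul_of_forall_eval_eq`, using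
`deg P.eval ≤ 2^s < D`, `totalDegree_eval_le_two_pow_size`).
[cite: MulmuleySohoniSIAM2001, Prop. 7.9 (AV p.33, all.txt L2442–2449)] -/
theorem MS2001_prop_7_9_general {τ : Type v} [Fintype τ] {f : MvPolynomial τ (ZMod p)} {d : ℕ}
    (hf : f.IsHomogeneous d) {P : ArithCircuit (ZMod p) τ} (h2 : P.IsFanInTwo)
    (hP : ∀ z : τ → ZMod p, eval z P.eval = eval z f) {k m : ℕ} (hk : P.size + 1 ≤ k)
    (hm : Fintype.card τ + P.size + 1 ≤ m) (hd : d < 2 ^ (k + 1) - 1) (ι : τ → Var k m)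
    (y : Var k m) :
    ∃ h : MvPolynomial (Var k m) F, IsFpForm p F h ∧
      IsFpEquivalent p F h (X y ^ (2 ^ (k + 1) - 1 - d) *
        rename ι (MvPolynomial.map (ZMod.castHom (dvd_refl p) F) f)) ∧
      h ∈ orbitClosure (genericCircuitForm F k m) := by
  classical
  set cast : ZMod p →+* F := ZMod.castHom (dvd_refl p) F with hcast
  set D : ℕ := 2 ^ (k + 1) - 1 with hD
  -- degree bookkeeping: `deg P.eval ≤ 2^s < D`
  have hdegP : P.eval.totalDegree < D := by
    have h1 : P.eval.totalDegree ≤ 2 ^ P.size := totalDegree_eval_le_two_pow_size h2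
    have h2' : 2 ^ P.size ≤ 2 ^ (k - 1) := Nat.pow_le_pow_right two_pos (by omega)
    have h3 : 2 ^ (k + 1) = 2 ^ (k - 1) * 4 := by
      rw [show k + 1 = (k - 1) + 2 by omega, pow_add]
      norm_num
    omega
  -- the witness: the homogenised circuit polynomial, over `F_p`
  set h₀ : MvPolynomial (Var k m) (ZMod p) :=
    ∑ i ∈ Finset.range (D + 1), X y ^ (D - i) * rename ι (homogeneousComponent i P.eval) with hh₀
  refine ⟨MvPolynomial.map cast h₀, isFpForm_map h₀, ?_, ?_⟩
  · -- `F_p`-equivalence: reduce to the computation over `F_p`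
    have hmapφ : X y ^ (D - d) * rename ι (MvPolynomial.map cast f) =
        MvPolynomial.map cast (X y ^ (D - d) * rename ι f) := by
      rw [_root_.map_mul, _root_.map_pow, map_X, map_rename]
    rw [hmapφ, isFpEquivalent_map_iff]
    intro x
    exact eval_homogenization_eq_X_pow_mul_of_forall_eval_eq hf hd hdegP hP ι y x
  · -- membership: the base change of the homogenisation is the homogenisation of the base
    -- change, which is a projection of `H(Y)` over `F`
    have hmap : MvPolynomial.map cast h₀ = ∑ i ∈ Finset.range (D + 1),
        X y ^ (D - i) * rename ι (homogeneousComponent i (MvPolynomial.map cast P.eval)) := by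
      rw [hh₀, _root_.map_sum]
      refine Finset.sum_congr rfl fun i _ => ?_
      rw [_root_.map_mul, _root_.map_pow, map_X, map_rename, homogeneousComponent_map']
    rw [hmap]
    have hproj : IsProjection (MvPolynomial.map cast P.eval) (genericCircuitForm F k m) := by
      rw [← map_genericCircuitForm cast k m]
      exact isProjection_map' cast (isProjection_eval h2 hk hm)
    exact endOrbit_subset_orbitClosure_holds _
      (homogenization_mem_endOrbit_of_isProjection
        (isHomogeneous_genericCircuitForm F k m (by omega)) hproj
        ((totalDegree_map_le' cast P.eval).trans hdegP.le) ι y)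

/-- **GCT I, Prop. 7.9** (Mulmuley–Sohoni 2001, AV p.33, all.txt L2442–2449): "If `E(X)`,
considered as a function of the `F_p`-vector `X`, has an arithmetic circuit over `F_p` of size
`r`, then some `F_p`-form `h` that is `F_p`-equivalent to `E^φ(Y)` lies in the projective orbit
closure `Δ[H(Y)] ⊆ P(V)`, where the size `l` of `Y` is `O(r²)`. *Proof:* Analogous to that of
Proposition 4.1." Here `E(X) = msE` is the form of GCT I §7 for the `n × kk·n` variable matrix
`X` (degree `n · kk^n`, integer coefficients), the circuit is a fan-in-two `ArithCircuit` over
`ZMod p` with `s` gates agreeing with `E(X)` on `F_p^X`, `H(Y) = genericCircuitForm F k m` with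
`k ≥ s + 1`, `m ≥ n·(n·kk) + s + 1` and `n · kk^n < 2^{k+1} - 1` (print: `l = O(r²)`; exact `l` in
`MS2001GenericCircuit.card_var`), `E^φ(Y) = X_y^{D - n kk^n} E(X_ι)` for any placement `ι`, `y`,
and `F` is any infinite field of characteristic `p` (print: `\overline{F_p}`). Instance of
`MS2001_prop_7_9_general`. [cite: MulmuleySohoniSIAM2001, Prop. 7.9 (AV p.33, all.txt L2442–2449)] -/
theorem MS2001_prop_7_9 {n kk : ℕ} {P : ArithCircuit (ZMod p) (Fin n × (Fin n × Fin kk))}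
    (h2 : P.IsFanInTwo)
    (hP : ∀ z : Fin n × (Fin n × Fin kk) → ZMod p, eval z P.eval = eval z (msE (ZMod p) n kk))
    {k m : ℕ} (hk : P.size + 1 ≤ k) (hm : n * (n * kk) + P.size + 1 ≤ m)
    (hd : n * kk ^ n < 2 ^ (k + 1) - 1) (ι : Fin n × (Fin n × Fin kk) → Var k m) (y : Var k m) :
    ∃ h : MvPolynomial (Var k m) F, IsFpForm p F h ∧
      IsFpEquivalent p F h (X y ^ (2 ^ (k + 1) - 1 - n * kk ^ n) * rename ι (msE F n kk)) ∧
      h ∈ orbitClosure (genericCircuitForm F k m) := by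
  have hm' : Fintype.card (Fin n × (Fin n × Fin kk)) + P.size + 1 ≤ m := by
    simpa [Fintype.card_prod, Fintype.card_fin] using hm
  have h := MS2001_prop_7_9_general p F (MS2001FormE.msE_isHomogeneous (F := ZMod p) n kk) h2 hP
    hk hm' hd ι y
  rwa [map_msE] at h

end PropSevenNine

end Literature.Computability.AlgebraicComplexity
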